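import Summits.QuantumFields.YangMills.Theorems.FluctuationComparisonRegPrIntLBeyondOneLoopInteriorDoor
import Summits.QuantumFields.YangMills.Theorems.FluctuationComparisonRegPrIntLLoopLedgerGasOfProductFormula
import Summits.QuantumFields.YangMills.Theorems.FluctuationComparisonRegPrIntLS2BetaKPLogRep
import Literature.Probability.LatticeModels.PolymerPressure
import HarnessLib

/-!
# THE INTERIOR GAS DOOR FOR ROW 2 OF THE S2β TABLE: the gas format ⟨GAS⟩ ∕ ⟨GAS∘⟩ and px20's product-formula letter ⟨ECE⟩ GIVE the REGISTERED interior row H4ᶜ∘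
# `BeyondOneLoopSmallIntCan` VERBATIM — KPL by name, window restriction, the split for SCL; NO other organ (no EXW ∕ GAP♯ ∕ CHART ∕ SCL hypothesis)

Cell `ym3-torus` (YM ladder rung R3 = continuum `SU(2)` Yang–Mills on the three-torus — a RUNG, NOT d = 4, NOT infinite volume, NOT a mass gap, NOT Clay).  Seat `ymfull-r3-prover-2`
(gen 0; R600-ym: hand = the REGISTERED stub `stub_beyondOneLoopSmallIntCan : BeyondOneLoopSmallIntCan`, registry `Cruxes/FluctuationComparisonRegPrIntL/Lines/semiclassical_s2beta.lean`
v11.4 `def` l.571 ∕ stub l.1580; PLAN `Lines/loop_ledger.lean` v6); `--supports stmt-QuantumFields-20520 --as helper`, count-neutral, definition-free, default heartbeats; no registry,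
binder or `Lines/` edit (RULING №36 untouched).  Companion of FILE 1 ✓`…BeyondOneLoopInteriorDoor` (the REP road: ⟨SCL∘⟩ → ⟨REP∘⟩ → H4ᶜ∘, full ⟹ interior).

WHAT.  LINE g19-2 §3d offers the organ hand the GAS door `BeyondOneLoopGasCan` («ON THE WINDOW `f¹ = c + F₀ + log Ξ(w_·)`, `w` a V-local Kotecký–Preiss gas of one-bond size `≤ Φ J`»,
[Balaban1987RG1] (0.26) ∕ [Balaban1989LargeFieldII] (1.90), (1.97)) with ✓`beyondOneLoopRep_of_gas'` (KPL by name), and px20 g15's ✓p783037 `beyondOneLoopGas_of_productFormula : ⟨ECE⟩ → ⟨GAS⟩`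
(«a λ-uniform exponentiated cluster expansion in PRODUCT FORM `heightDensityCan(γ∕λ)·e^{β_K(γ∕λ)m} = C_λ·ℓ·Ξ(w^λ)` with `log Ξ(w^λ) → 0`»).  Both end at the FULL window.  This file
re-docks them to the REGISTERED interior row, texts δ-unfolded exactly as in ✓p783037 (`gasZ` ↦ `(polymerPartitionFunction polyInc (X ↦ ↑(w U X)) univ).re`, `KPGasOn`, `PolymerRepOn`,
`fluctAtCan`, `oneLoopPartCan` ∕ `oneLoopFourPtCan` ↦ `limUnder atTop …`, `heightDensityCan` ↦ `Node00.canonVersion …`):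
* ★ `repInt_of_gasInt : ⟨GAS∘⟩ → ⟨REP∘⟩` — KPL BY NAME (✓`…S2BetaKPLogRep.kpLogRep'`, pen ym-ust-20520-w3 g15 ✓p744986): `R := log Ξ(w_·)`, `a := Φ J`; ⟨GAS∘⟩ = GAS with the registry's
  two ∘-moves (fraction prefix after `∀ L`; the domination and identity window clauses at `cw * b₀`; history `b₀`).
* ★ `gasInt_of_gas : ⟨GAS⟩ → ⟨GAS∘⟩` (`c₀ := 1`, `γ₁ ↦ min γ₁ 1`; only the field-uniform domination `|w_U X| ≤ w̄ X` and the identity see the window, and interior ⊆ full by lit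
  ✓`T3InteriorExcision.θBal_mul_le` + ✓`T3PrintedMinimiserExistence.plaqSmall_of_le`).
* ★★ `beyondOneLoopSmallInt_of_gasInt : ⟨SCL∘⟩ → ⟨GAS∘⟩ → ⟨BeyondOneLoopSmallIntCan VERBATIM⟩` (FILE 1's ✓`beyondOneLoopSmallInt_of_repInt` ∘ `repInt_of_gasInt`); the full-window
  composite ⟨SCL⟩ → ⟨GAS⟩ → H4ᶜ∘ is `fun hS hG => beyondOneLoopSmallInt_of_gasInt (sclInt_of_scl hS) (gasInt_of_gas hG)` (door-fit cert).
* ★ `scl_of_productFormula : ⟨ECE⟩ → ⟨SCL⟩` — the product formula splits `f^λ U = log C_λ + log ℓ U + log Ξ(w^λ_U)` on the window (✓`log_add_eq_of_mul_exp_eq`), so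
  `f^λ U − f^λ 𝟙 → log ℓ U − log ℓ 𝟙` (✓`tendsto_sub_of_split`, px20's §1; `𝟙` is a window datum by lit ✓`plaqSmall_one` ∘ ✓`θBal_pos`, `γ₁ ↦ min γ₁ 1`).
* ★★★ `beyondOneLoopSmallInt_of_productFormula : ⟨ECE⟩ → ⟨BeyondOneLoopSmallIntCan VERBATIM⟩` — px20's ONE letter ⟨ECE⟩ (REP's prefix VERBATIM + the product package per depth)
  delivers the REGISTERED row 2 with NO other organ: SCL by the split, GAS by ✓p783037, interior by restriction, REP by KPL, H4ᶜ∘ by FILE 1.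
Door-fit (HOME cert `ymfull-r3-prover-2/g0/DOORFIT-BeyondOneLoopInteriorGasDoor.cert.lean`, registry v11.4 + loop_ledger v6 texts pasted): `example : SemiclassicalLimitCan →
BeyondOneLoopGasCan → BeyondOneLoopSmallIntCan := fun hS hG => beyondOneLoopSmallInt_of_gasInt (sclInt_of_scl hS) (gasInt_of_gas hG)` and `example : ⟨ECE⟩ → BeyondOneLoopSmallIntCan := beyondOneLoopSmallInt_of_productFormula`.

HONEST SCOPE.  Filter ∕ logarithm ∕ finite-sum algebra and quantifier plumbing; ⟨GAS⟩, ⟨GAS∘⟩, ⟨SCL⟩, ⟨ECE⟩ are HYPOTHESES (⟨GAS⟩ ∕ ⟨ECE⟩ = the XL small-field cluster expansion of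
[Balaban1987RG1] Thm 1 ∕ [Balaban1988Convergent] read in d = 3 — nobody's theorem); nothing of Bałaban's is asserted or proved; `BeyondOneLoopSmallIntCan`, the other four registered
∘-stubs, S2β and `FluctuationComparisonRegPrIntL` (stmt-QuantumFields-20520) are NOT proved; no summit statement is proved by a helper; rung R3 = SU(2) YM₃ on T³ — finite volume,
conditional; NOT d = 4, NOT infinite volume, NOT a mass gap, NOT Clay; the Yang–Mills mass gap is NOT proved.

References: T. Bałaban, CMP **102** (1985) 255–275 [Balaban1985UV3] ((7) p.257, (41)–(47) pp.266–267); CMP **109** (1987) 249–301 [Balaban1987RG1] (Thm 1, (0.17)–(0.26) pp.255–257);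
CMP **122** (1989) 355–392 [Balaban1989LargeFieldII] ((1.90) p.388, (1.97)–(1.100) pp.389–390); R. Kotecký, D. Preiss, CMP **103** (1986) 491–498 [KoteckyPreiss1986] (Theorem p.492).
-/

noncomputable section

open MeasureTheory Filter Topology Set
open Literature.Probability.LatticeModels (polymerPartitionFunction polyInc)
open Literature.MathematicalPhysics.QuantumFieldTheory.Balaban1983to89
open Literature.MathematicalPhysics.QuantumFieldTheory.Balaban1983to89.T3ContinuumYM3Torus
open Literature.MathematicalPhysics.QuantumFieldTheory.Balaban1983to89.T3NestedUnitLaws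
open Literature.MathematicalPhysics.QuantumFieldTheory.Balaban1983to89.T3UnitLawDensityEML
open Literature.MathematicalPhysics.QuantumFieldTheory.Balaban1983to89.T3UnitScaleTilt
open Literature.MathematicalPhysics.QuantumFieldTheory.Balaban1983to89.T3TiltDescent
open Literature.MathematicalPhysics.QuantumFieldTheory.Balaban1983to89.T3PrintedRegularMinimiser
open Summit.QuantumFields.YangMills.Theorems.BeyondOneLoopInteriorDoor
open Summit.QuantumFields.YangMills.Theorems.LoopLedgerGasOfProductFormula

namespace Summit.QuantumFields.YangMills.Theorems.BeyondOneLoopInteriorGasDoor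

open Classical in
/-- ★ **KPL ⇒ ⟨GAS∘⟩ ⇒ ⟨REP∘⟩ (KPL BY NAME).**  At every depth `R := log Ξ(w_·)`, `a := Φ J`; the Kotecký–Preiss gas on the interior window is represented there by
✓`…S2BetaKPLogRep.kpLogRep'` (LINE g19-2's `beyondOneLoopRep_of_gas`, interior edition, δ-unfolded). [cite: Balaban1989LargeFieldII, (1.98)-(1.99) p.390; KoteckyPreiss1986, Theorem p.492 (2),(4)] -/
theorem repInt_of_gasInt
    (hG : ∀ (L : ℕ), ∃ c₀ : ℝ, 0 < c₀ ∧ c₀ ≤ 1 ∧ ∀ (cw : ℝ), 0 < cw → cw ≤ c₀ →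
      ∃ pS : ℝ, ∀ (b₀ p₀ : ℝ), 0 < b₀ → pS ≤ p₀ → 0 < p₀ → ∃ ε₁ : ℝ, 0 < ε₁ ∧ ∀ (ε₀ : ℝ), 0 < ε₀ → ε₀ ≤ ε₁ →
      ∃ γ₁ : ℝ, 0 < γ₁ ∧ ∃ κ : ℝ, 0 < κ ∧
        ∀ (F : T3Family) (γ : ℝ), F.L = L → 0 < γ → γ ≤ γ₁ →
          ∃ Φ : ℕ → ℝ, (∀ J, 0 ≤ Φ J) ∧ Tendsto (fun J : ℕ => (J : ℝ) * Φ J) atTop (𝓝 0) ∧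
            ∀ (J K : ℕ) (hJK : J ≤ K),
              ∃ (c : ℝ) (w : GaugeField (F.P J) 0 (Matrix.specialUnitaryGroup (Fin 2) ℂ) → Finset (PBond (F.P J) 0) → ℝ),
                (∃ (wbar a ℓ : Finset (PBond (F.P J) 0) → ℝ),
                (∀ U, w U ∅ = 0) ∧
                (∀ (X : Finset (PBond (F.P J) 0)) (U U' : GaugeField (F.P J) 0 (Matrix.specialUnitaryGroup (Fin 2) ℂ)),
                  (∀ e ∈ X, U e = U' e) → w U X = w U' X) ∧
                (∀ X, 0 ≤ a X) ∧ (∀ X, 0 ≤ ℓ X) ∧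
                (∀ U, U ∈ {U : GaugeField (F.P J) 0 (Matrix.specialUnitaryGroup (Fin 2) ℂ) | PlaqSmall (θBal F.L γ (cw * b₀) p₀ J) U} → ∀ X, |w U X| ≤ wbar X) ∧
                (∀ X : Finset (PBond (F.P J) 0), ∀ e ∈ X, ∀ e' ∈ X, (e.src.tdist e'.src : ℝ) ≤ ℓ X) ∧
                (∀ X : Finset (PBond (F.P J) 0), ∑ X' ∈ Finset.univ.filter (fun X' => polyInc X' X),
                    wbar X' * Real.exp (a X' + κ * ℓ X') ≤ a X) ∧
                (∀ e : PBond (F.P J) 0, a {e} ≤ (Φ J))) ∧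
                ∀ U : GaugeField (F.P J) 0 (Matrix.specialUnitaryGroup (Fin 2) ℂ), PlaqSmall (θBal F.L γ (cw * b₀) p₀ J) U →
                  (Real.log (Node00.canonVersion (fieldMeasure (F.P J) 0 (Matrix.specialUnitaryGroup (Fin 2) ℂ))
                      (heightDensity F (γ / 1) hJK (histGood F ℰp (θBal F.L γ b₀ p₀) K J)) U)
                    + (F.scheme ℰp (γ / 1)).β K * minActionRegPr F J K hJK ε₀ U)
                    = c + limUnder atTop (fun lam : ℝ => (Real.log (Node00.canonVersion (fieldMeasure (F.P J) 0 (Matrix.specialUnitaryGroup (Fin 2) ℂ))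
                      (heightDensity F (γ / lam) hJK (histGood F ℰp (θBal F.L γ b₀ p₀) K J)) U)
                    + (F.scheme ℰp (γ / lam)).β K * minActionRegPr F J K hJK ε₀ U) - (Real.log (Node00.canonVersion (fieldMeasure (F.P J) 0 (Matrix.specialUnitaryGroup (Fin 2) ℂ))
                      (heightDensity F (γ / lam) hJK (histGood F ℰp (θBal F.L γ b₀ p₀) K J)) 1)
                    + (F.scheme ℰp (γ / lam)).β K * minActionRegPr F J K hJK ε₀ 1))
                      + Real.log (polymerPartitionFunction polyInc (fun X : Finset (PBond (F.P J) 0) => ((w U X : ℝ) : ℂ)) Finset.univ).re) :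
    ∀ (L : ℕ), ∃ c₀ : ℝ, 0 < c₀ ∧ c₀ ≤ 1 ∧ ∀ (cw : ℝ), 0 < cw → cw ≤ c₀ →
      ∃ pS : ℝ, ∀ (b₀ p₀ : ℝ), 0 < b₀ → pS ≤ p₀ → 0 < p₀ → ∃ ε₁ : ℝ, 0 < ε₁ ∧ ∀ (ε₀ : ℝ), 0 < ε₀ → ε₀ ≤ ε₁ →
      ∃ γ₁ : ℝ, 0 < γ₁ ∧ ∃ κ : ℝ, 0 < κ ∧
        ∀ (F : T3Family) (γ : ℝ), F.L = L → 0 < γ → γ ≤ γ₁ →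
          ∃ Φ : ℕ → ℝ, (∀ J, 0 ≤ Φ J) ∧ Tendsto (fun J : ℕ => (J : ℝ) * Φ J) atTop (𝓝 0) ∧
            ∀ (J K : ℕ) (hJK : J ≤ K),
              ∃ (c : ℝ) (R : GaugeField (F.P J) 0 (Matrix.specialUnitaryGroup (Fin 2) ℂ) → ℝ) (a : ℝ),
                (∀ U : GaugeField (F.P J) 0 (Matrix.specialUnitaryGroup (Fin 2) ℂ), PlaqSmall (θBal F.L γ (cw * b₀) p₀ J) U →
                  (Real.log (Node00.canonVersion (fieldMeasure (F.P J) 0 (Matrix.specialUnitaryGroup (Fin 2) ℂ)) (heightDensity F (γ / 1) hJK (histGood F ℰp (θBal F.L γ b₀ p₀) K J)) U) + (F.scheme ℰp (γ / 1)).β K * minActionRegPr F J K hJK ε₀ U)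
                      = c + limUnder atTop (fun lam : ℝ => (Real.log (Node00.canonVersion (fieldMeasure (F.P J) 0 (Matrix.specialUnitaryGroup (Fin 2) ℂ)) (heightDensity F (γ / lam) hJK (histGood F ℰp (θBal F.L γ b₀ p₀) K J)) U) + (F.scheme ℰp (γ / lam)).β K * minActionRegPr F J K hJK ε₀ U)
                          - (Real.log (Node00.canonVersion (fieldMeasure (F.P J) 0 (Matrix.specialUnitaryGroup (Fin 2) ℂ)) (heightDensity F (γ / lam) hJK (histGood F ℰp (θBal F.L γ b₀ p₀) K J)) 1) + (F.scheme ℰp (γ / lam)).β K * minActionRegPr F J K hJK ε₀ 1)) + R U) ∧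
                (∃ (n : ℕ) (supp : Fin n → Finset (PBond (F.P J) 0)) (len wt : Fin n → ℝ) (act : Fin n → GaugeField (F.P J) 0 (Matrix.specialUnitaryGroup (Fin 2) ℂ) → ℝ) (c' : ℝ),
                  (∀ X (U U' : GaugeField (F.P J) 0 (Matrix.specialUnitaryGroup (Fin 2) ℂ)), (∀ e ∈ supp X, U e = U' e) → act X U = act X U') ∧
                  (∀ X, 0 ≤ wt X) ∧
                  (∀ X, ∀ e ∈ supp X, ∀ e' ∈ supp X, (e.src.tdist e'.src : ℝ) ≤ len X) ∧
                  (∀ X U, U ∈ {U : GaugeField (F.P J) 0 (Matrix.specialUnitaryGroup (Fin 2) ℂ) | PlaqSmall (θBal F.L γ (cw * b₀) p₀ J) U} → |act X U| ≤ wt X) ∧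
                  (∀ e : PBond (F.P J) 0, ∑ X ∈ Finset.univ.filter (fun X => e ∈ supp X), wt X * Real.exp (κ * len X) ≤ a) ∧
                  ∀ U, U ∈ {U : GaugeField (F.P J) 0 (Matrix.specialUnitaryGroup (Fin 2) ℂ) | PlaqSmall (θBal F.L γ (cw * b₀) p₀ J) U} →
                    R U = c' + ∑ X, act X U) ∧
                a ≤ Φ J := by
  intro L
  obtain ⟨c₀, hc₀, hc₀1, H⟩ := hG L
  refine ⟨c₀, hc₀, hc₀1, fun cw hcw hcwle => ?_⟩
  obtain ⟨pS, H0⟩ := H cw hcw hcwle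
  refine ⟨pS, fun b₀ p₀ hb hp hp0 => ?_⟩
  obtain ⟨ε₁, hε₁, H1⟩ := H0 b₀ p₀ hb hp hp0
  refine ⟨ε₁, hε₁, fun ε₀ hε₀ hε₀le => ?_⟩
  obtain ⟨γ₁, hγ₁, κ, hκ, H2⟩ := H1 ε₀ hε₀ hε₀le
  refine ⟨γ₁, hγ₁, κ, hκ, fun F γ hFL hγ hγle => ?_⟩
  obtain ⟨Φ, hΦ0, hΦ, H3⟩ := H2 F γ hFL hγ hγle
  refine ⟨Φ, hΦ0, hΦ, fun J K hJK => ?_⟩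
  obtain ⟨c, w, hgas, hid⟩ := H3 J K hJK
  exact ⟨c, fun U => Real.log ((polymerPartitionFunction polyInc (fun X : Finset (PBond (F.P J) 0) => ((w U X : ℝ) : ℂ)) Finset.univ).re), Φ J, hid,
    Summit.QuantumFields.YangMills.Theorems.FluctuationComparisonRegPrIntLS2BetaKPLogRep.kpLogRep'
      {U : GaugeField (F.P J) 0 (Matrix.specialUnitaryGroup (Fin 2) ℂ) | PlaqSmall (θBal F.L γ (cw * b₀) p₀ J) U} κ (Φ J) hκ.le w hgas, le_rfl⟩

open Classical in
/-- ★ **FULL WINDOW ⟹ INTERIOR WINDOW FOR GAS**: `BeyondOneLoopGasCan` of LINE g19-2 (δ-unfolded) gives ⟨GAS∘⟩ with `c₀ := 1`, `γ₁ ↦ min γ₁ 1` — only the domination clause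
`∀ U ∈ window, |w_U X| ≤ w̄ X` and the identity see the window, and they restrict to the interior window (a subset of the full one for `cw ≤ 1`, `γ ≤ 1`).
[cite: Balaban1985UV3, (7) p.257; Balaban1989LargeFieldII, (1.97) p.389] -/
theorem gasInt_of_gas
    (hG : ∀ (L : ℕ), ∃ pS : ℝ, ∀ (b₀ p₀ : ℝ), 0 < b₀ → pS ≤ p₀ → 0 < p₀ → ∃ ε₁ : ℝ, 0 < ε₁ ∧ ∀ (ε₀ : ℝ), 0 < ε₀ → ε₀ ≤ ε₁ →
      ∃ γ₁ : ℝ, 0 < γ₁ ∧ ∃ κ : ℝ, 0 < κ ∧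
        ∀ (F : T3Family) (γ : ℝ), F.L = L → 0 < γ → γ ≤ γ₁ →
          ∃ Φ : ℕ → ℝ, (∀ J, 0 ≤ Φ J) ∧ Tendsto (fun J : ℕ => (J : ℝ) * Φ J) atTop (𝓝 0) ∧
            ∀ (J K : ℕ) (hJK : J ≤ K),
              ∃ (c : ℝ) (w : GaugeField (F.P J) 0 (Matrix.specialUnitaryGroup (Fin 2) ℂ) → Finset (PBond (F.P J) 0) → ℝ),
                (∃ (wbar a ℓ : Finset (PBond (F.P J) 0) → ℝ),
                (∀ U, w U ∅ = 0) ∧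
                (∀ (X : Finset (PBond (F.P J) 0)) (U U' : GaugeField (F.P J) 0 (Matrix.specialUnitaryGroup (Fin 2) ℂ)),
                  (∀ e ∈ X, U e = U' e) → w U X = w U' X) ∧
                (∀ X, 0 ≤ a X) ∧ (∀ X, 0 ≤ ℓ X) ∧
                (∀ U, U ∈ {U : GaugeField (F.P J) 0 (Matrix.specialUnitaryGroup (Fin 2) ℂ) | PlaqSmall (θBal F.L γ b₀ p₀ J) U} → ∀ X, |w U X| ≤ wbar X) ∧
                (∀ X : Finset (PBond (F.P J) 0), ∀ e ∈ X, ∀ e' ∈ X, (e.src.tdist e'.src : ℝ) ≤ ℓ X) ∧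
                (∀ X : Finset (PBond (F.P J) 0), ∑ X' ∈ Finset.univ.filter (fun X' => polyInc X' X),
                    wbar X' * Real.exp (a X' + κ * ℓ X') ≤ a X) ∧
                (∀ e : PBond (F.P J) 0, a {e} ≤ (Φ J))) ∧
                ∀ U : GaugeField (F.P J) 0 (Matrix.specialUnitaryGroup (Fin 2) ℂ), PlaqSmall (θBal F.L γ b₀ p₀ J) U →
                  (Real.log (Node00.canonVersion (fieldMeasure (F.P J) 0 (Matrix.specialUnitaryGroup (Fin 2) ℂ))
                      (heightDensity F (γ / 1) hJK (histGood F ℰp (θBal F.L γ b₀ p₀) K J)) U)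
                    + (F.scheme ℰp (γ / 1)).β K * minActionRegPr F J K hJK ε₀ U)
                    = c + limUnder atTop (fun lam : ℝ => (Real.log (Node00.canonVersion (fieldMeasure (F.P J) 0 (Matrix.specialUnitaryGroup (Fin 2) ℂ))
                      (heightDensity F (γ / lam) hJK (histGood F ℰp (θBal F.L γ b₀ p₀) K J)) U)
                    + (F.scheme ℰp (γ / lam)).β K * minActionRegPr F J K hJK ε₀ U) - (Real.log (Node00.canonVersion (fieldMeasure (F.P J) 0 (Matrix.specialUnitaryGroup (Fin 2) ℂ))
                      (heightDensity F (γ / lam) hJK (histGood F ℰp (θBal F.L γ b₀ p₀) K J)) 1)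
                    + (F.scheme ℰp (γ / lam)).β K * minActionRegPr F J K hJK ε₀ 1))
                      + Real.log (polymerPartitionFunction polyInc (fun X : Finset (PBond (F.P J) 0) => ((w U X : ℝ) : ℂ)) Finset.univ).re) :
    ∀ (L : ℕ), ∃ c₀ : ℝ, 0 < c₀ ∧ c₀ ≤ 1 ∧ ∀ (cw : ℝ), 0 < cw → cw ≤ c₀ →
      ∃ pS : ℝ, ∀ (b₀ p₀ : ℝ), 0 < b₀ → pS ≤ p₀ → 0 < p₀ → ∃ ε₁ : ℝ, 0 < ε₁ ∧ ∀ (ε₀ : ℝ), 0 < ε₀ → ε₀ ≤ ε₁ →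
      ∃ γ₁ : ℝ, 0 < γ₁ ∧ ∃ κ : ℝ, 0 < κ ∧
        ∀ (F : T3Family) (γ : ℝ), F.L = L → 0 < γ → γ ≤ γ₁ →
          ∃ Φ : ℕ → ℝ, (∀ J, 0 ≤ Φ J) ∧ Tendsto (fun J : ℕ => (J : ℝ) * Φ J) atTop (𝓝 0) ∧
            ∀ (J K : ℕ) (hJK : J ≤ K),
              ∃ (c : ℝ) (w : GaugeField (F.P J) 0 (Matrix.specialUnitaryGroup (Fin 2) ℂ) → Finset (PBond (F.P J) 0) → ℝ),
                (∃ (wbar a ℓ : Finset (PBond (F.P J) 0) → ℝ),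
                (∀ U, w U ∅ = 0) ∧
                (∀ (X : Finset (PBond (F.P J) 0)) (U U' : GaugeField (F.P J) 0 (Matrix.specialUnitaryGroup (Fin 2) ℂ)),
                  (∀ e ∈ X, U e = U' e) → w U X = w U' X) ∧
                (∀ X, 0 ≤ a X) ∧ (∀ X, 0 ≤ ℓ X) ∧
                (∀ U, U ∈ {U : GaugeField (F.P J) 0 (Matrix.specialUnitaryGroup (Fin 2) ℂ) | PlaqSmall (θBal F.L γ (cw * b₀) p₀ J) U} → ∀ X, |w U X| ≤ wbar X) ∧
                (∀ X : Finset (PBond (F.P J) 0), ∀ e ∈ X, ∀ e' ∈ X, (e.src.tdist e'.src : ℝ) ≤ ℓ X) ∧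
                (∀ X : Finset (PBond (F.P J) 0), ∑ X' ∈ Finset.univ.filter (fun X' => polyInc X' X),
                    wbar X' * Real.exp (a X' + κ * ℓ X') ≤ a X) ∧
                (∀ e : PBond (F.P J) 0, a {e} ≤ (Φ J))) ∧
                ∀ U : GaugeField (F.P J) 0 (Matrix.specialUnitaryGroup (Fin 2) ℂ), PlaqSmall (θBal F.L γ (cw * b₀) p₀ J) U →
                  (Real.log (Node00.canonVersion (fieldMeasure (F.P J) 0 (Matrix.specialUnitaryGroup (Fin 2) ℂ))
                      (heightDensity F (γ / 1) hJK (histGood F ℰp (θBal F.L γ b₀ p₀) K J)) U)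
                    + (F.scheme ℰp (γ / 1)).β K * minActionRegPr F J K hJK ε₀ U)
                    = c + limUnder atTop (fun lam : ℝ => (Real.log (Node00.canonVersion (fieldMeasure (F.P J) 0 (Matrix.specialUnitaryGroup (Fin 2) ℂ))
                      (heightDensity F (γ / lam) hJK (histGood F ℰp (θBal F.L γ b₀ p₀) K J)) U)
                    + (F.scheme ℰp (γ / lam)).β K * minActionRegPr F J K hJK ε₀ U) - (Real.log (Node00.canonVersion (fieldMeasure (F.P J) 0 (Matrix.specialUnitaryGroup (Fin 2) ℂ))
                      (heightDensity F (γ / lam) hJK (histGood F ℰp (θBal F.L γ b₀ p₀) K J)) 1)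
                    + (F.scheme ℰp (γ / lam)).β K * minActionRegPr F J K hJK ε₀ 1))
                      + Real.log (polymerPartitionFunction polyInc (fun X : Finset (PBond (F.P J) 0) => ((w U X : ℝ) : ℂ)) Finset.univ).re := by
  intro L
  obtain ⟨pS, H⟩ := hG L
  refine ⟨1, one_pos, le_rfl, fun cw hcw hcw1 => ⟨pS, fun b₀ p₀ hb hp hp0 => ?_⟩⟩
  obtain ⟨ε₁, hε₁, H1⟩ := H b₀ p₀ hb hp hp0
  refine ⟨ε₁, hε₁, fun ε₀ hε₀ hε₀le => ?_⟩
  obtain ⟨γ₁, hγ₁, κ, hκ, H2⟩ := H1 ε₀ hε₀ hε₀le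
  refine ⟨min γ₁ 1, lt_min hγ₁ one_pos, κ, hκ, fun F γ hFL hγ hγle => ?_⟩
  obtain ⟨Φ, hΦ0, hΦ, H3⟩ := H2 F γ hFL hγ (hγle.trans (min_le_left _ _))
  refine ⟨Φ, hΦ0, hΦ, fun J K hJK => ?_⟩
  obtain ⟨c, w, ⟨wbar, a, ℓ, h0, hloc, ha, hℓ, hdom, hdiam, hKP, hpin⟩, hid⟩ := H3 J K hJK
  have hθ : θBal F.L γ (cw * b₀) p₀ J ≤ θBal F.L γ b₀ p₀ J :=
    T3InteriorExcision.θBal_mul_le (le_of_lt F.hL.2) hγ (hγle.trans (min_le_right _ _)) hb hcw1 p₀ J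
  have hsub : ∀ U : GaugeField (F.P J) 0 (Matrix.specialUnitaryGroup (Fin 2) ℂ),
      PlaqSmall (θBal F.L γ (cw * b₀) p₀ J) U → PlaqSmall (θBal F.L γ b₀ p₀ J) U :=
    fun U hU => T3PrintedMinimiserExistence.plaqSmall_of_le hθ hU
  exact ⟨c, w, ⟨wbar, a, ℓ, h0, hloc, ha, hℓ, fun U hU => hdom U (hsub U hU), hdiam, hKP, hpin⟩, fun U hU => hid U (hsub U hU)⟩

open Classical in
/-- ★★ **⟨SCL∘⟩ → ⟨GAS∘⟩ → H4ᶜ∘ `BeyondOneLoopSmallIntCan` VERBATIM** — FILE 1's ✓`beyondOneLoopSmallInt_of_repInt` after `repInt_of_gasInt` (LINE g19-2's `beyondOneLoopSmallCan_of_gas'`,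
interior edition). [cite: Balaban1985UV3, (45)-(47) p.267; Balaban1987RG1, (0.22)-(0.26) pp.256-257] -/
theorem beyondOneLoopSmallInt_of_gasInt
    (hS : ∀ (L : ℕ), ∃ c₀ : ℝ, 0 < c₀ ∧ c₀ ≤ 1 ∧ ∀ (cw : ℝ), 0 < cw → cw ≤ c₀ →
      ∃ pS : ℝ, ∀ (b₀ p₀ : ℝ), 0 < b₀ → pS ≤ p₀ → 0 < p₀ → ∃ ε₁ : ℝ, 0 < ε₁ ∧ ∀ (ε₀ : ℝ), 0 < ε₀ → ε₀ ≤ ε₁ →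
      ∃ γ₁ : ℝ, 0 < γ₁ ∧ ∀ (F : T3Family) (γ : ℝ), F.L = L → 0 < γ → γ ≤ γ₁ →
        ∀ (J K : ℕ) (hJK : J ≤ K) (V : GaugeField (F.P J) 0 (Matrix.specialUnitaryGroup (Fin 2) ℂ)), PlaqSmall (θBal F.L γ (cw * b₀) p₀ J) V →
          ∃ a : ℝ, Tendsto (fun lam : ℝ =>
            (Real.log (Node00.canonVersion (fieldMeasure (F.P J) 0 (Matrix.specialUnitaryGroup (Fin 2) ℂ)) (heightDensity F (γ / lam) hJK (histGood F ℰp (θBal F.L γ b₀ p₀) K J)) V) + (F.scheme ℰp (γ / lam)).β K * minActionRegPr F J K hJK ε₀ V)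
            - (Real.log (Node00.canonVersion (fieldMeasure (F.P J) 0 (Matrix.specialUnitaryGroup (Fin 2) ℂ)) (heightDensity F (γ / lam) hJK (histGood F ℰp (θBal F.L γ b₀ p₀) K J)) 1) + (F.scheme ℰp (γ / lam)).β K * minActionRegPr F J K hJK ε₀ 1)) atTop (𝓝 a))
    (hG : ∀ (L : ℕ), ∃ c₀ : ℝ, 0 < c₀ ∧ c₀ ≤ 1 ∧ ∀ (cw : ℝ), 0 < cw → cw ≤ c₀ →
      ∃ pS : ℝ, ∀ (b₀ p₀ : ℝ), 0 < b₀ → pS ≤ p₀ → 0 < p₀ → ∃ ε₁ : ℝ, 0 < ε₁ ∧ ∀ (ε₀ : ℝ), 0 < ε₀ → ε₀ ≤ ε₁ →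
      ∃ γ₁ : ℝ, 0 < γ₁ ∧ ∃ κ : ℝ, 0 < κ ∧
        ∀ (F : T3Family) (γ : ℝ), F.L = L → 0 < γ → γ ≤ γ₁ →
          ∃ Φ : ℕ → ℝ, (∀ J, 0 ≤ Φ J) ∧ Tendsto (fun J : ℕ => (J : ℝ) * Φ J) atTop (𝓝 0) ∧
            ∀ (J K : ℕ) (hJK : J ≤ K),
              ∃ (c : ℝ) (w : GaugeField (F.P J) 0 (Matrix.specialUnitaryGroup (Fin 2) ℂ) → Finset (PBond (F.P J) 0) → ℝ),
                (∃ (wbar a ℓ : Finset (PBond (F.P J) 0) → ℝ),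
                (∀ U, w U ∅ = 0) ∧
                (∀ (X : Finset (PBond (F.P J) 0)) (U U' : GaugeField (F.P J) 0 (Matrix.specialUnitaryGroup (Fin 2) ℂ)),
                  (∀ e ∈ X, U e = U' e) → w U X = w U' X) ∧
                (∀ X, 0 ≤ a X) ∧ (∀ X, 0 ≤ ℓ X) ∧
                (∀ U, U ∈ {U : GaugeField (F.P J) 0 (Matrix.specialUnitaryGroup (Fin 2) ℂ) | PlaqSmall (θBal F.L γ (cw * b₀) p₀ J) U} → ∀ X, |w U X| ≤ wbar X) ∧
                (∀ X : Finset (PBond (F.P J) 0), ∀ e ∈ X, ∀ e' ∈ X, (e.src.tdist e'.src : ℝ) ≤ ℓ X) ∧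
                (∀ X : Finset (PBond (F.P J) 0), ∑ X' ∈ Finset.univ.filter (fun X' => polyInc X' X),
                    wbar X' * Real.exp (a X' + κ * ℓ X') ≤ a X) ∧
                (∀ e : PBond (F.P J) 0, a {e} ≤ (Φ J))) ∧
                ∀ U : GaugeField (F.P J) 0 (Matrix.specialUnitaryGroup (Fin 2) ℂ), PlaqSmall (θBal F.L γ (cw * b₀) p₀ J) U →
                  (Real.log (Node00.canonVersion (fieldMeasure (F.P J) 0 (Matrix.specialUnitaryGroup (Fin 2) ℂ))
                      (heightDensity F (γ / 1) hJK (histGood F ℰp (θBal F.L γ b₀ p₀) K J)) U)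
                    + (F.scheme ℰp (γ / 1)).β K * minActionRegPr F J K hJK ε₀ U)
                    = c + limUnder atTop (fun lam : ℝ => (Real.log (Node00.canonVersion (fieldMeasure (F.P J) 0 (Matrix.specialUnitaryGroup (Fin 2) ℂ))
                      (heightDensity F (γ / lam) hJK (histGood F ℰp (θBal F.L γ b₀ p₀) K J)) U)
                    + (F.scheme ℰp (γ / lam)).β K * minActionRegPr F J K hJK ε₀ U) - (Real.log (Node00.canonVersion (fieldMeasure (F.P J) 0 (Matrix.specialUnitaryGroup (Fin 2) ℂ))
                      (heightDensity F (γ / lam) hJK (histGood F ℰp (θBal F.L γ b₀ p₀) K J)) 1)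
                    + (F.scheme ℰp (γ / lam)).β K * minActionRegPr F J K hJK ε₀ 1))
                      + Real.log (polymerPartitionFunction polyInc (fun X : Finset (PBond (F.P J) 0) => ((w U X : ℝ) : ℂ)) Finset.univ).re) :
    ∀ (L : ℕ), ∃ c₀ : ℝ, 0 < c₀ ∧ c₀ ≤ 1 ∧ ∀ (c : ℝ), 0 < c → c ≤ c₀ → ∃ pS : ℝ, ∀ (b₀ p₀ : ℝ), 0 < b₀ → pS ≤ p₀ → 0 < p₀ →
      ∃ ε₁ : ℝ, 0 < ε₁ ∧ ∀ (ε₀ : ℝ), 0 < ε₀ → ε₀ ≤ ε₁ →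
      ∃ γ₁ : ℝ, 0 < γ₁ ∧ ∃ κ : ℝ, 0 < κ ∧ ∀ (F : T3Family) (γ : ℝ), F.L = L → 0 < γ → γ ≤ γ₁ →
        ∃ φ₂ : ℕ → ℝ, (∀ J, 0 ≤ φ₂ J) ∧ Tendsto (fun J : ℕ => (J : ℝ) * φ₂ J) atTop (𝓝 0) ∧
          ∀ (J K : ℕ) (hJK : J ≤ K) (b b' : PBond (F.P J) 0) (U V W Z : GaugeField (F.P J) 0 (Matrix.specialUnitaryGroup (Fin 2) ℂ)),
            PlaqSmall (θBal F.L γ (c * b₀) p₀ J) U → PlaqSmall (θBal F.L γ (c * b₀) p₀ J) V →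
            PlaqSmall (θBal F.L γ (c * b₀) p₀ J) W → PlaqSmall (θBal F.L γ (c * b₀) p₀ J) Z →
            (∀ e, e ≠ b → U e = V e) → (∀ e, e ≠ b' → U e = W e) → (∀ e, e ≠ b' → V e = Z e) → (∀ e, e ≠ b → W e = Z e) →
            |(((Real.log (Node00.canonVersion (fieldMeasure (F.P J) 0 (Matrix.specialUnitaryGroup (Fin 2) ℂ)) (heightDensity F (γ / 1) hJK (histGood F ℰp (θBal F.L γ b₀ p₀) K J)) U) + (F.scheme ℰp (γ / 1)).β K * minActionRegPr F J K hJK ε₀ U)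
                - (Real.log (Node00.canonVersion (fieldMeasure (F.P J) 0 (Matrix.specialUnitaryGroup (Fin 2) ℂ)) (heightDensity F (γ / 1) hJK (histGood F ℰp (θBal F.L γ b₀ p₀) K J)) V) + (F.scheme ℰp (γ / 1)).β K * minActionRegPr F J K hJK ε₀ V))
              - ((Real.log (Node00.canonVersion (fieldMeasure (F.P J) 0 (Matrix.specialUnitaryGroup (Fin 2) ℂ)) (heightDensity F (γ / 1) hJK (histGood F ℰp (θBal F.L γ b₀ p₀) K J)) W) + (F.scheme ℰp (γ / 1)).β K * minActionRegPr F J K hJK ε₀ W)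
                - (Real.log (Node00.canonVersion (fieldMeasure (F.P J) 0 (Matrix.specialUnitaryGroup (Fin 2) ℂ)) (heightDensity F (γ / 1) hJK (histGood F ℰp (θBal F.L γ b₀ p₀) K J)) Z) + (F.scheme ℰp (γ / 1)).β K * minActionRegPr F J K hJK ε₀ Z)))
              - limUnder atTop (fun lam : ℝ =>
                ((Real.log (Node00.canonVersion (fieldMeasure (F.P J) 0 (Matrix.specialUnitaryGroup (Fin 2) ℂ)) (heightDensity F (γ / lam) hJK (histGood F ℰp (θBal F.L γ b₀ p₀) K J)) U) + (F.scheme ℰp (γ / lam)).β K * minActionRegPr F J K hJK ε₀ U)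
                  - (Real.log (Node00.canonVersion (fieldMeasure (F.P J) 0 (Matrix.specialUnitaryGroup (Fin 2) ℂ)) (heightDensity F (γ / lam) hJK (histGood F ℰp (θBal F.L γ b₀ p₀) K J)) V) + (F.scheme ℰp (γ / lam)).β K * minActionRegPr F J K hJK ε₀ V))
                - ((Real.log (Node00.canonVersion (fieldMeasure (F.P J) 0 (Matrix.specialUnitaryGroup (Fin 2) ℂ)) (heightDensity F (γ / lam) hJK (histGood F ℰp (θBal F.L γ b₀ p₀) K J)) W) + (F.scheme ℰp (γ / lam)).β K * minActionRegPr F J K hJK ε₀ W)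
                  - (Real.log (Node00.canonVersion (fieldMeasure (F.P J) 0 (Matrix.specialUnitaryGroup (Fin 2) ℂ)) (heightDensity F (γ / lam) hJK (histGood F ℰp (θBal F.L γ b₀ p₀) K J)) Z) + (F.scheme ℰp (γ / lam)).β K * minActionRegPr F J K hJK ε₀ Z)))|
              ≤ φ₂ J * Real.exp (-(κ * (b.src.tdist b'.src : ℝ))) :=
  beyondOneLoopSmallInt_of_repInt hS (repInt_of_gasInt hG)

open Classical in
/-- ★ **⟨ECE⟩ → ⟨SCL⟩: THE PRODUCT FORMULA GIVES THE POINTWISE SEMICLASSICAL LIMIT ON THE WINDOW.**  On the window and for `λ ≥ 1` the product formula reads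
`f^λ U = log C_λ + log ℓ U + log Ξ(w^λ_U)` (✓`log_add_eq_of_mul_exp_eq`); with `log Ξ(w^λ_·) → 0` the normalised family `f^λ U − f^λ 𝟙 → log ℓ U − log ℓ 𝟙`
(✓`tendsto_sub_of_split`; `𝟙` is a window datum by lit ✓`plaqSmall_one` ∘ ✓`θBal_pos`, `γ₁ ↦ min γ₁ 1`).  So px20's letter carries LINE g19-2's SCL with no Laplace input.
[cite: Balaban1987RG1, (0.17)-(0.22) pp.255-256; Balaban1985Variational, Thm 1 (8) p.279] -/
theorem scl_of_productFormula
    (hECE : ∀ (L : ℕ), ∃ pS : ℝ, ∀ (b₀ p₀ : ℝ), 0 < b₀ → pS ≤ p₀ → 0 < p₀ → ∃ ε₁ : ℝ, 0 < ε₁ ∧ ∀ (ε₀ : ℝ), 0 < ε₀ → ε₀ ≤ ε₁ →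
      ∃ γ₁ : ℝ, 0 < γ₁ ∧ ∃ κ : ℝ, 0 < κ ∧
        ∀ (F : T3Family) (γ : ℝ), F.L = L → 0 < γ → γ ≤ γ₁ →
          ∃ Φ : ℕ → ℝ, (∀ J, 0 ≤ Φ J) ∧ Tendsto (fun J : ℕ => (J : ℝ) * Φ J) atTop (𝓝 0) ∧
            ∀ (J K : ℕ) (hJK : J ≤ K),
              ∃ (Cl : ℝ → ℝ) (ell : GaugeField (F.P J) 0 (Matrix.specialUnitaryGroup (Fin 2) ℂ) → ℝ)
                (w : ℝ → GaugeField (F.P J) 0 (Matrix.specialUnitaryGroup (Fin 2) ℂ) → Finset (PBond (F.P J) 0) → ℝ),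
              (∀ lam : ℝ, 1 ≤ lam → 0 < Cl lam) ∧
              (∀ U : GaugeField (F.P J) 0 (Matrix.specialUnitaryGroup (Fin 2) ℂ), PlaqSmall (θBal F.L γ b₀ p₀ J) U → 0 < ell U) ∧
              (∃ (wbar a ℓ : Finset (PBond (F.P J) 0) → ℝ),
                (∀ U, w 1 U ∅ = 0) ∧
                (∀ (X : Finset (PBond (F.P J) 0)) (U U' : GaugeField (F.P J) 0 (Matrix.specialUnitaryGroup (Fin 2) ℂ)),
                  (∀ e ∈ X, U e = U' e) → w 1 U X = w 1 U' X) ∧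
                (∀ X, 0 ≤ a X) ∧ (∀ X, 0 ≤ ℓ X) ∧
                (∀ U, U ∈ {U : GaugeField (F.P J) 0 (Matrix.specialUnitaryGroup (Fin 2) ℂ) | PlaqSmall (θBal F.L γ b₀ p₀ J) U} → ∀ X, |w 1 U X| ≤ wbar X) ∧
                (∀ X : Finset (PBond (F.P J) 0), ∀ e ∈ X, ∀ e' ∈ X, (e.src.tdist e'.src : ℝ) ≤ ℓ X) ∧
                (∀ X : Finset (PBond (F.P J) 0), ∑ X' ∈ Finset.univ.filter (fun X' => polyInc X' X),
                    wbar X' * Real.exp (a X' + κ * ℓ X') ≤ a X) ∧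
                (∀ e : PBond (F.P J) 0, a {e} ≤ (Φ J))) ∧
              (∀ lam : ℝ, 1 ≤ lam → ∀ U : GaugeField (F.P J) 0 (Matrix.specialUnitaryGroup (Fin 2) ℂ), PlaqSmall (θBal F.L γ b₀ p₀ J) U →
                0 < (polymerPartitionFunction polyInc (fun X : Finset (PBond (F.P J) 0) => ((w lam U X : ℝ) : ℂ)) Finset.univ).re ∧
                Node00.canonVersion (fieldMeasure (F.P J) 0 (Matrix.specialUnitaryGroup (Fin 2) ℂ))
                    (heightDensity F (γ / lam) hJK (histGood F ℰp (θBal F.L γ b₀ p₀) K J)) U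
                  * Real.exp ((F.scheme ℰp (γ / lam)).β K * minActionRegPr F J K hJK ε₀ U)
                = Cl lam * ell U * (polymerPartitionFunction polyInc (fun X : Finset (PBond (F.P J) 0) => ((w lam U X : ℝ) : ℂ)) Finset.univ).re) ∧
              (∀ U : GaugeField (F.P J) 0 (Matrix.specialUnitaryGroup (Fin 2) ℂ), PlaqSmall (θBal F.L γ b₀ p₀ J) U →
                Tendsto (fun lam : ℝ => Real.log (polymerPartitionFunction polyInc (fun X : Finset (PBond (F.P J) 0) => ((w lam U X : ℝ) : ℂ)) Finset.univ).re) atTop (𝓝 0))) :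
    ∀ (L : ℕ), ∃ pS : ℝ, ∀ (b₀ p₀ : ℝ), 0 < b₀ → pS ≤ p₀ → 0 < p₀ → ∃ ε₁ : ℝ, 0 < ε₁ ∧ ∀ (ε₀ : ℝ), 0 < ε₀ → ε₀ ≤ ε₁ →
      ∃ γ₁ : ℝ, 0 < γ₁ ∧ ∀ (F : T3Family) (γ : ℝ), F.L = L → 0 < γ → γ ≤ γ₁ →
        ∀ (J K : ℕ) (hJK : J ≤ K) (V : GaugeField (F.P J) 0 (Matrix.specialUnitaryGroup (Fin 2) ℂ)), PlaqSmall (θBal F.L γ b₀ p₀ J) V →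
          ∃ a : ℝ, Tendsto (fun lam : ℝ =>
            (Real.log (Node00.canonVersion (fieldMeasure (F.P J) 0 (Matrix.specialUnitaryGroup (Fin 2) ℂ)) (heightDensity F (γ / lam) hJK (histGood F ℰp (θBal F.L γ b₀ p₀) K J)) V) + (F.scheme ℰp (γ / lam)).β K * minActionRegPr F J K hJK ε₀ V)
            - (Real.log (Node00.canonVersion (fieldMeasure (F.P J) 0 (Matrix.specialUnitaryGroup (Fin 2) ℂ)) (heightDensity F (γ / lam) hJK (histGood F ℰp (θBal F.L γ b₀ p₀) K J)) 1) + (F.scheme ℰp (γ / lam)).β K * minActionRegPr F J K hJK ε₀ 1)) atTop (𝓝 a) := by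
  intro L
  obtain ⟨pS, H⟩ := hECE L
  refine ⟨pS, fun b₀ p₀ hb hp hp0 => ?_⟩
  obtain ⟨ε₁, hε₁, H1⟩ := H b₀ p₀ hb hp hp0
  refine ⟨ε₁, hε₁, fun ε₀ hε₀ hε₀le => ?_⟩
  obtain ⟨γ₁, hγ₁, κ, -, H2⟩ := H1 ε₀ hε₀ hε₀le
  refine ⟨min γ₁ 1, lt_min hγ₁ one_pos, fun F γ hFL hγ hγle J K hJK V hV => ?_⟩
  obtain ⟨Φ, -, -, H3⟩ := H2 F γ hFL hγ (hγle.trans (min_le_left _ _))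
  obtain ⟨Cl, ell, w, hCl, hell, -, hprodZ, hlim⟩ := H3 J K hJK
  have h1 : PlaqSmall (θBal F.L γ b₀ p₀ J) (1 : GaugeField (F.P J) 0 (Matrix.specialUnitaryGroup (Fin 2) ℂ)) :=
    T3DescentFibreTower.plaqSmall_one (T3MinimiserStabilityReduction.θBal_pos (le_of_lt F.hL.2) hγ (hγle.trans (min_le_right _ _)) hb p₀ J)
  have hsplit : ∀ lam : ℝ, 1 ≤ lam → ∀ U, U ∈ {U : GaugeField (F.P J) 0 (Matrix.specialUnitaryGroup (Fin 2) ℂ) | PlaqSmall (θBal F.L γ b₀ p₀ J) U} →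
      (fun (lam : ℝ) (U : GaugeField (F.P J) 0 (Matrix.specialUnitaryGroup (Fin 2) ℂ)) =>
          Real.log (Node00.canonVersion (fieldMeasure (F.P J) 0 (Matrix.specialUnitaryGroup (Fin 2) ℂ))
              (heightDensity F (γ / lam) hJK (histGood F ℰp (θBal F.L γ b₀ p₀) K J)) U)
            + (F.scheme ℰp (γ / lam)).β K * minActionRegPr F J K hJK ε₀ U) lam U
        = (fun lam : ℝ => Real.log (Cl lam)) lam + (fun U => Real.log (ell U)) U
          + (fun (lam : ℝ) (U : GaugeField (F.P J) 0 (Matrix.specialUnitaryGroup (Fin 2) ℂ)) =>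
              Real.log ((polymerPartitionFunction polyInc (fun X : Finset (PBond (F.P J) 0) => ((w lam U X : ℝ) : ℂ)) Finset.univ).re)) lam U :=
    fun lam hlam U hU => log_add_eq_of_mul_exp_eq (hCl lam hlam) (hell U hU) (hprodZ lam hlam U hU).1 (hprodZ lam hlam U hU).2
  exact ⟨Real.log (ell V) - Real.log (ell 1), tendsto_sub_of_split hsplit (fun U hU => hlim U hU) hV h1⟩

open Classical in
/-- ★★★ **⟨ECE⟩ → H4ᶜ∘ `BeyondOneLoopSmallIntCan` VERBATIM — px20's ONE LETTER DELIVERS THE REGISTERED ROW 2 WITH NO OTHER ORGAN.**  ⟨ECE⟩ («λ-uniform exponentiated cluster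
expansion in product form», REP's prefix VERBATIM then per depth `Cl, ell, w` with KP data for `w 1`, positivity + the product formula for every `λ ≥ 1`, `log Ξ(w^λ) → 0`):
SCL by `scl_of_productFormula`, GAS by ✓p783037 `beyondOneLoopGas_of_productFormula`, interior by `sclInt_of_scl` ∕ `gasInt_of_gas`, then `beyondOneLoopSmallInt_of_gasInt`.  Door-fit: `example : ⟨ECE⟩ → BeyondOneLoopSmallIntCan :=
beyondOneLoopSmallInt_of_productFormula`. [cite: Balaban1987RG1, Thm 1 (0.19)-(0.26) pp.255-257; Balaban1985UV3, (45)-(47) p.267; Balaban1988Convergent, Thm 1] -/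
theorem beyondOneLoopSmallInt_of_productFormula
    (hECE : ∀ (L : ℕ), ∃ pS : ℝ, ∀ (b₀ p₀ : ℝ), 0 < b₀ → pS ≤ p₀ → 0 < p₀ → ∃ ε₁ : ℝ, 0 < ε₁ ∧ ∀ (ε₀ : ℝ), 0 < ε₀ → ε₀ ≤ ε₁ →
      ∃ γ₁ : ℝ, 0 < γ₁ ∧ ∃ κ : ℝ, 0 < κ ∧
        ∀ (F : T3Family) (γ : ℝ), F.L = L → 0 < γ → γ ≤ γ₁ →
          ∃ Φ : ℕ → ℝ, (∀ J, 0 ≤ Φ J) ∧ Tendsto (fun J : ℕ => (J : ℝ) * Φ J) atTop (𝓝 0) ∧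
            ∀ (J K : ℕ) (hJK : J ≤ K),
              ∃ (Cl : ℝ → ℝ) (ell : GaugeField (F.P J) 0 (Matrix.specialUnitaryGroup (Fin 2) ℂ) → ℝ)
                (w : ℝ → GaugeField (F.P J) 0 (Matrix.specialUnitaryGroup (Fin 2) ℂ) → Finset (PBond (F.P J) 0) → ℝ),
              (∀ lam : ℝ, 1 ≤ lam → 0 < Cl lam) ∧
              (∀ U : GaugeField (F.P J) 0 (Matrix.specialUnitaryGroup (Fin 2) ℂ), PlaqSmall (θBal F.L γ b₀ p₀ J) U → 0 < ell U) ∧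
              (∃ (wbar a ℓ : Finset (PBond (F.P J) 0) → ℝ),
                (∀ U, w 1 U ∅ = 0) ∧
                (∀ (X : Finset (PBond (F.P J) 0)) (U U' : GaugeField (F.P J) 0 (Matrix.specialUnitaryGroup (Fin 2) ℂ)),
                  (∀ e ∈ X, U e = U' e) → w 1 U X = w 1 U' X) ∧
                (∀ X, 0 ≤ a X) ∧ (∀ X, 0 ≤ ℓ X) ∧
                (∀ U, U ∈ {U : GaugeField (F.P J) 0 (Matrix.specialUnitaryGroup (Fin 2) ℂ) | PlaqSmall (θBal F.L γ b₀ p₀ J) U} → ∀ X, |w 1 U X| ≤ wbar X) ∧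
                (∀ X : Finset (PBond (F.P J) 0), ∀ e ∈ X, ∀ e' ∈ X, (e.src.tdist e'.src : ℝ) ≤ ℓ X) ∧
                (∀ X : Finset (PBond (F.P J) 0), ∑ X' ∈ Finset.univ.filter (fun X' => polyInc X' X),
                    wbar X' * Real.exp (a X' + κ * ℓ X') ≤ a X) ∧
                (∀ e : PBond (F.P J) 0, a {e} ≤ (Φ J))) ∧
              (∀ lam : ℝ, 1 ≤ lam → ∀ U : GaugeField (F.P J) 0 (Matrix.specialUnitaryGroup (Fin 2) ℂ), PlaqSmall (θBal F.L γ b₀ p₀ J) U →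
                0 < (polymerPartitionFunction polyInc (fun X : Finset (PBond (F.P J) 0) => ((w lam U X : ℝ) : ℂ)) Finset.univ).re ∧
                Node00.canonVersion (fieldMeasure (F.P J) 0 (Matrix.specialUnitaryGroup (Fin 2) ℂ))
                    (heightDensity F (γ / lam) hJK (histGood F ℰp (θBal F.L γ b₀ p₀) K J)) U
                  * Real.exp ((F.scheme ℰp (γ / lam)).β K * minActionRegPr F J K hJK ε₀ U)
                = Cl lam * ell U * (polymerPartitionFunction polyInc (fun X : Finset (PBond (F.P J) 0) => ((w lam U X : ℝ) : ℂ)) Finset.univ).re) ∧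
              (∀ U : GaugeField (F.P J) 0 (Matrix.specialUnitaryGroup (Fin 2) ℂ), PlaqSmall (θBal F.L γ b₀ p₀ J) U →
                Tendsto (fun lam : ℝ => Real.log (polymerPartitionFunction polyInc (fun X : Finset (PBond (F.P J) 0) => ((w lam U X : ℝ) : ℂ)) Finset.univ).re) atTop (𝓝 0))) :
    ∀ (L : ℕ), ∃ c₀ : ℝ, 0 < c₀ ∧ c₀ ≤ 1 ∧ ∀ (c : ℝ), 0 < c → c ≤ c₀ → ∃ pS : ℝ, ∀ (b₀ p₀ : ℝ), 0 < b₀ → pS ≤ p₀ → 0 < p₀ →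
      ∃ ε₁ : ℝ, 0 < ε₁ ∧ ∀ (ε₀ : ℝ), 0 < ε₀ → ε₀ ≤ ε₁ →
      ∃ γ₁ : ℝ, 0 < γ₁ ∧ ∃ κ : ℝ, 0 < κ ∧ ∀ (F : T3Family) (γ : ℝ), F.L = L → 0 < γ → γ ≤ γ₁ →
        ∃ φ₂ : ℕ → ℝ, (∀ J, 0 ≤ φ₂ J) ∧ Tendsto (fun J : ℕ => (J : ℝ) * φ₂ J) atTop (𝓝 0) ∧
          ∀ (J K : ℕ) (hJK : J ≤ K) (b b' : PBond (F.P J) 0) (U V W Z : GaugeField (F.P J) 0 (Matrix.specialUnitaryGroup (Fin 2) ℂ)),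
            PlaqSmall (θBal F.L γ (c * b₀) p₀ J) U → PlaqSmall (θBal F.L γ (c * b₀) p₀ J) V →
            PlaqSmall (θBal F.L γ (c * b₀) p₀ J) W → PlaqSmall (θBal F.L γ (c * b₀) p₀ J) Z →
            (∀ e, e ≠ b → U e = V e) → (∀ e, e ≠ b' → U e = W e) → (∀ e, e ≠ b' → V e = Z e) → (∀ e, e ≠ b → W e = Z e) →
            |(((Real.log (Node00.canonVersion (fieldMeasure (F.P J) 0 (Matrix.specialUnitaryGroup (Fin 2) ℂ)) (heightDensity F (γ / 1) hJK (histGood F ℰp (θBal F.L γ b₀ p₀) K J)) U) + (F.scheme ℰp (γ / 1)).β K * minActionRegPr F J K hJK ε₀ U)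
                - (Real.log (Node00.canonVersion (fieldMeasure (F.P J) 0 (Matrix.specialUnitaryGroup (Fin 2) ℂ)) (heightDensity F (γ / 1) hJK (histGood F ℰp (θBal F.L γ b₀ p₀) K J)) V) + (F.scheme ℰp (γ / 1)).β K * minActionRegPr F J K hJK ε₀ V))
              - ((Real.log (Node00.canonVersion (fieldMeasure (F.P J) 0 (Matrix.specialUnitaryGroup (Fin 2) ℂ)) (heightDensity F (γ / 1) hJK (histGood F ℰp (θBal F.L γ b₀ p₀) K J)) W) + (F.scheme ℰp (γ / 1)).β K * minActionRegPr F J K hJK ε₀ W)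
                - (Real.log (Node00.canonVersion (fieldMeasure (F.P J) 0 (Matrix.specialUnitaryGroup (Fin 2) ℂ)) (heightDensity F (γ / 1) hJK (histGood F ℰp (θBal F.L γ b₀ p₀) K J)) Z) + (F.scheme ℰp (γ / 1)).β K * minActionRegPr F J K hJK ε₀ Z)))
              - limUnder atTop (fun lam : ℝ =>
                ((Real.log (Node00.canonVersion (fieldMeasure (F.P J) 0 (Matrix.specialUnitaryGroup (Fin 2) ℂ)) (heightDensity F (γ / lam) hJK (histGood F ℰp (θBal F.L γ b₀ p₀) K J)) U) + (F.scheme ℰp (γ / lam)).β K * minActionRegPr F J K hJK ε₀ U)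
                  - (Real.log (Node00.canonVersion (fieldMeasure (F.P J) 0 (Matrix.specialUnitaryGroup (Fin 2) ℂ)) (heightDensity F (γ / lam) hJK (histGood F ℰp (θBal F.L γ b₀ p₀) K J)) V) + (F.scheme ℰp (γ / lam)).β K * minActionRegPr F J K hJK ε₀ V))
                - ((Real.log (Node00.canonVersion (fieldMeasure (F.P J) 0 (Matrix.specialUnitaryGroup (Fin 2) ℂ)) (heightDensity F (γ / lam) hJK (histGood F ℰp (θBal F.L γ b₀ p₀) K J)) W) + (F.scheme ℰp (γ / lam)).β K * minActionRegPr F J K hJK ε₀ W)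
                  - (Real.log (Node00.canonVersion (fieldMeasure (F.P J) 0 (Matrix.specialUnitaryGroup (Fin 2) ℂ)) (heightDensity F (γ / lam) hJK (histGood F ℰp (θBal F.L γ b₀ p₀) K J)) Z) + (F.scheme ℰp (γ / lam)).β K * minActionRegPr F J K hJK ε₀ Z)))|
              ≤ φ₂ J * Real.exp (-(κ * (b.src.tdist b'.src : ℝ))) :=
  beyondOneLoopSmallInt_of_gasInt (sclInt_of_scl (scl_of_productFormula hECE)) (gasInt_of_gas (beyondOneLoopGas_of_productFormula hECE))

end Summit.QuantumFields.YangMills.Theorems.BeyondOneLoopInteriorGasDoor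

end
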